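import Summits.CriticalPhenomena.PercolationContinuityZ3.Theorems.Transplant.FKThreeApexOmega
import HarnessLib

/-!
# The three-apex monoid: the T3 Rayleigh form (two leaf edges at different apices and different leaves) in closed form

Helper file (`--supports stmt-CriticalPhenomena-4575`), FK sub-lane `prim-bschramm-fk-3` (gen 14); builds on p205010 (kernel theorem, internal audit
signed; external expert review pending).  Pure algebra (`ring`), no sorries; standard axioms.  Memo `bschramm/prim-bschramm-fk-3/DISJOINT-VIA-U.md` §4.

Type T3 is the last pair type of the weighted `K_{1,1,1,n}`: the leaf edge `u₁a` (leaf `u₁` with remaining probabilities `b₁, c₁`) against the leaf edge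
`u₂b` (leaf `u₂` with remaining probabilities `a₂, c₂`).  By Cauchy–Binet in hat coordinates `(û,x̂,ŷ,ẑ,v̂)` of the rest `R`, the pinned Rayleigh
difference is the quadratic form `t3Form` with the ten explicit product coefficients below (`rayleigh_T3_eq`, by `ring`); its non-negativity on the
monoid (T3) is NOT proved here. [folklore]
-/

noncomputable section

namespace Summit.CriticalPhenomena.PercolationContinuityZ3.Theorems

namespace FK

namespace ThreeApex

/-- The T3 Rayleigh form in hat coordinates `û = Z₀, x̂ = Z₀+Z_ab, ŷ = Z₀+Z_ac, ẑ = Z₀+Z_bc, v̂ = |Z|` (leaf `u₁ = (·, b₁, c₁)` pinned on its `a`-edge,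
leaf `u₂ = (a₂, ·, c₂)` pinned on its `b`-edge; `λ, μ` the `Z₀`-masses of the deleted leaves, `λ', μ'` their totals). [folklore] -/
def t3Form (q b₁ c₁ a₂ c₂ : ℝ) (Z : V5) : ℝ :=
  let r := 1 - q
  let p := 2 - q
  let lam := q * (1 - b₁) * (1 - c₁) + b₁ * (1 - c₁) + (1 - b₁) * c₁
  let lam' := lam + b₁ * c₁
  let mu := q * (1 - a₂) * (1 - c₂) + a₂ * (1 - c₂) + (1 - a₂) * c₂
  let mu' := mu + a₂ * c₂
  let u := Z.z0
  let x := hx Z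
  let y := hy Z
  let z := hz Z
  let v := Z.total
  q ^ 2 * r ^ 2 * p * lam * mu * b₁ * (1 - c₁) * a₂ * (1 - c₂) * (u * x)
  - q ^ 2 * r ^ 2 * p * lam * (1 - b₁) * c₁ * (1 - a₂) * (1 - c₂) * a₂ * c₂ * (u * y)
  - q ^ 2 * r ^ 2 * p * mu * (1 - b₁) * (1 - c₁) * b₁ * c₁ * (1 - a₂) * c₂ * (u * z)
  - q ^ 2 * r * p * (lam - (1 - b₁) * (1 - c₁) * lam') * (mu - (1 - a₂) * (1 - c₂) * mu') * (u * v)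
  - q ^ 2 * r ^ 2 * lam * (b₁ - c₁) * (1 - c₂) * a₂ * (mu + c₂) * (x * y)
  - q ^ 2 * r ^ 2 * (1 - c₁) * b₁ * (lam + c₁) * mu * (a₂ - c₂) * (x * z)
  + q ^ 2 * r * c₁ * c₂ * (1 - b₁) * (1 - a₂) * (q * (1 - c₁) + c₁) * (q * (1 - c₂) + c₂) * (x * v)
  + q ^ 2 * r ^ 2 * (1 - b₁) * (1 - a₂) * c₁ * c₂ * (lam + b₁) * (mu + a₂) * (y * z)
  + q ^ 2 * r * b₁ * (1 - c₁) * (q * (1 - b₁) + b₁) * mu' * (1 - (1 - a₂) * (1 - c₂)) * (y * v)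
  + q ^ 2 * r * lam' * (1 - (1 - b₁) * (1 - c₁)) * a₂ * (1 - c₂) * (q * (1 - a₂) + a₂) * (z * v)

/-- `Z¹¹` (both leaf edges contracted) in hat coordinates of the rest. [folklore] -/
theorem val_pin11 (q b₁ c₁ a₂ c₂ : ℝ) (R : V5) :
    val q (conv (leaf q 1 b₁ c₁) (conv (leaf q a₂ 1 c₂) R)) =
      (q * (1 - q) * (2 - q)) * ((1 - b₁) * (1 - c₁)) * ((1 - a₂) * (1 - c₂)) * R.z0 + (-(q * (1 - q))) * ((1 - c₁)) * ((1 - c₂)) * hx R + (-(q * (1 - q))) * ((1 - b₁)) * ((1 - a₂) * (1 - c₂)) * hy R + (-(q * (1 - q))) * ((1 - b₁) * (1 - c₁)) * ((1 - a₂)) * hz R + q * (1) * (1) * R.total := by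
  simp only [val, conv, leaf, hx, hy, hz, V5.total]
  ring

/-- `Z¹⁰` (`u₁a` contracted, `u₂b` deleted) in hat coordinates of the rest. [folklore] -/
theorem val_pin10 (q b₁ c₁ a₂ c₂ : ℝ) (R : V5) :
    val q (conv (leaf q 1 b₁ c₁) (conv (leaf q a₂ 0 c₂) R)) =
      (q * (1 - q) * (2 - q)) * ((1 - b₁) * (1 - c₁)) * ((q * (1 - a₂) * (1 - c₂) + a₂ * (1 - c₂) + (1 - a₂) * c₂)) * R.z0 + (-(q * (1 - q))) * ((1 - c₁)) * ((q * (1 - a₂) * (1 - c₂) + a₂ * (1 - c₂) + (1 - a₂) * c₂)) * hx R + (-(q * (1 - q))) * ((1 - b₁)) * ((q * (1 - a₂) * (1 - c₂) + a₂ * (1 - c₂) + (1 - a₂) * c₂ + a₂ * c₂)) * hy R + (-(q * (1 - q))) * ((1 - b₁) * (1 - c₁)) * ((q * (1 - a₂) * (1 - c₂) + a₂ * (1 - c₂) + (1 - a₂) * c₂)) * hz R + q * (1) * ((q * (1 - a₂) * (1 - c₂) + a₂ * (1 - c₂) + (1 - a₂) * c₂ + a₂ * c₂)) * R.total := by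
  simp only [val, conv, leaf, hx, hy, hz, V5.total]
  ring

/-- `Z⁰¹` (`u₁a` deleted, `u₂b` contracted) in hat coordinates of the rest. [folklore] -/
theorem val_pin01 (q b₁ c₁ a₂ c₂ : ℝ) (R : V5) :
    val q (conv (leaf q 0 b₁ c₁) (conv (leaf q a₂ 1 c₂) R)) =
      (q * (1 - q) * (2 - q)) * ((q * (1 - b₁) * (1 - c₁) + b₁ * (1 - c₁) + (1 - b₁) * c₁)) * ((1 - a₂) * (1 - c₂)) * R.z0 + (-(q * (1 - q))) * ((q * (1 - b₁) * (1 - c₁) + b₁ * (1 - c₁) + (1 - b₁) * c₁)) * ((1 - c₂)) * hx R + (-(q * (1 - q))) * ((q * (1 - b₁) * (1 - c₁) + b₁ * (1 - c₁) + (1 - b₁) * c₁)) * ((1 - a₂) * (1 - c₂)) * hy R + (-(q * (1 - q))) * ((q * (1 - b₁) * (1 - c₁) + b₁ * (1 - c₁) + (1 - b₁) * c₁ + b₁ * c₁)) * ((1 - a₂)) * hz R + q * ((q * (1 - b₁) * (1 - c₁) + b₁ * (1 - c₁) + (1 - b₁) * c₁ + b₁ * c₁)) * (1) * R.total := by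
  simp only [val, conv, leaf, hx, hy, hz, V5.total]
  ring

/-- `Z⁰⁰` (both deleted) in hat coordinates of the rest. [folklore] -/
theorem val_pin00 (q b₁ c₁ a₂ c₂ : ℝ) (R : V5) :
    val q (conv (leaf q 0 b₁ c₁) (conv (leaf q a₂ 0 c₂) R)) =
      (q * (1 - q) * (2 - q)) * ((q * (1 - b₁) * (1 - c₁) + b₁ * (1 - c₁) + (1 - b₁) * c₁)) * ((q * (1 - a₂) * (1 - c₂) + a₂ * (1 - c₂) + (1 - a₂) * c₂)) * R.z0 + (-(q * (1 - q))) * ((q * (1 - b₁) * (1 - c₁) + b₁ * (1 - c₁) + (1 - b₁) * c₁)) * ((q * (1 - a₂) * (1 - c₂) + a₂ * (1 - c₂) + (1 - a₂) * c₂)) * hx R + (-(q * (1 - q))) * ((q * (1 - b₁) * (1 - c₁) + b₁ * (1 - c₁) + (1 - b₁) * c₁)) * ((q * (1 - a₂) * (1 - c₂) + a₂ * (1 - c₂) + (1 - a₂) * c₂ + a₂ * c₂)) * hy R + (-(q * (1 - q))) * ((q * (1 - b₁) * (1 - c₁) + b₁ * (1 - c₁) + (1 - b₁) * c₁ + b₁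 * c₁)) * ((q * (1 - a₂) * (1 - c₂) + a₂ * (1 - c₂) + (1 - a₂) * c₂)) * hz R + q * ((q * (1 - b₁) * (1 - c₁) + b₁ * (1 - c₁) + (1 - b₁) * c₁ + b₁ * c₁)) * ((q * (1 - a₂) * (1 - c₂) + a₂ * (1 - c₂) + (1 - a₂) * c₂ + a₂ * c₂)) * R.total := by
  simp only [val, conv, leaf, hx, hy, hz, V5.total]
  ring

set_option maxHeartbeats 4000000 in
/-- **Type T3** (leaf edge `u₁a` against leaf edge `u₂b`): the Rayleigh difference `Z¹⁰Z⁰¹ − Z¹¹Z⁰⁰` of the four pinned valuations is `t3Form`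
(Cauchy–Binet in hat coordinates). [folklore] -/
theorem rayleigh_T3_eq (q b₁ c₁ a₂ c₂ : ℝ) (R : V5) :
    val q (conv (leaf q 1 b₁ c₁) (conv (leaf q a₂ 0 c₂) R)) * val q (conv (leaf q 0 b₁ c₁) (conv (leaf q a₂ 1 c₂) R)) -
        val q (conv (leaf q 1 b₁ c₁) (conv (leaf q a₂ 1 c₂) R)) * val q (conv (leaf q 0 b₁ c₁) (conv (leaf q a₂ 0 c₂) R)) =
      t3Form q b₁ c₁ a₂ c₂ R := by
  rw [val_pin10, val_pin01, val_pin11, val_pin00]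
  simp only [t3Form]
  ring

end ThreeApex

end FK

end Summit.CriticalPhenomena.PercolationContinuityZ3.Theorems
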